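import Summits.AtomisticToContinuum.Crystallization.Theorems.ChartedPlanarOrderNashForceBalanceLayers
import Summits.AtomisticToContinuum.Crystallization.Theorems.OverbindingBudgetElasticSplitShear

/-!
# Planes line, P2a — the layered cube chunk as an indexed family; first counts (slot 7b seed, decomp-a2c lens-3)

* `dirSum_twelve_le` : `D₁₂ᵘ(F) ≤ 250 δ⁻¹² · #F` for a `δ`-separated chunk and `‖u‖ = 1` (cos² ≤ 1 + `sum_inv_pow_twelve_le_of_separated`);
* `card_cube_le`     : `#(Y ∩ cube(c, ℓ)) ≤ (2ℓ/δ + 1)³` (`card_le_of_separated_of_box`);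
* `layerPoint a b w (m, i, j) = (i•a + j•b) + w m`, `range_pt : Set.range (layerPoint a b w) = Layered a b w`, and ★ `pt_injective` under `IsStacked` +
  `LinearIndependent ℝ ![a, b]` (heights separate the layers, independence separates the cell);
* `sum_eq_sum_preimage` : a sum over a chunk `F ⊆ Layered a b w` is the sum over its index set `idx F ⊆ ℤ × ℤ × ℤ`, and
  `sum_layerwise` : `Σ_{x ∈ F} G(layer of x) = Σ_k N_k · G k` with the LAYER COUNTS `layerCount F k`.
-/

namespace Summit.AtomisticToContinuum.Crystallization.Theorems.ChartedPlanarOrderPlanesCount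

open scoped BigOperators RealInnerProductSpace
open Summit.AtomisticToContinuum.Crystallization.Theorems.ChartedPlanarOrderRigidityDoor (E3)
open Summit.AtomisticToContinuum.Crystallization.Theorems.ChartedPlanarOrderDoorLayered (Layered)
open Summit.AtomisticToContinuum.Crystallization.Theorems.ChartedPlanarOrderProfileSlavingLJ (IsStacked)
open Summit.AtomisticToContinuum.Crystallization.Theorems.ChartedPlanarOrderNashForceBalance (layerPoint layerPoint_mem layerPoint_injective)
open Summit.AtomisticToContinuum.Crystallization.Theorems.OverbindingBudgetElasticSplitDilation (enum enum_injective)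
open Summit.AtomisticToContinuum.Crystallization.Theorems.OverbindingBudgetElasticSplitShear (dirSum)
open Summit.AtomisticToContinuum.Crystallization.Theorems.OverbindingBudgetCubeTails (card_le_of_separated_of_box)
open Summit.AtomisticToContinuum.Crystallization.Theorems.ContactSaturationLadderDilationCharge (sum_inv_pow_twelve_le_of_separated)

/-! ## §1 Two counts for separated chunks -/

/-- `D₁₂ᵘ(F) ≤ 250 δ⁻¹² #F` for a `δ`-separated chunk (`cos² ≤ 1`). -/
theorem dirSum_twelve_le (u : E3) (hu : ‖u‖ = 1) (F : Finset E3) {δ : ℝ} (hδ : 0 < δ)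
    (hsep : ∀ z ∈ F, ∀ w ∈ F, z ≠ w → δ ≤ dist z w) : dirSum 12 u F ≤ 250 * δ⁻¹ ^ 12 * (F.card : ℝ) := by
  have hsep' : ∀ k l : Fin F.card, k ≠ l → δ ≤ dist (enum F k) (enum F l) := by
    intro k l hkl
    refine hsep _ ?_ _ ?_ (fun h => hkl (enum_injective F h))
    · exact (F.equivFin.symm k).2
    · exact (F.equivFin.symm l).2
  have key := sum_inv_pow_twelve_le_of_separated (enum F) Finset.univ hδ hsep'
  rw [Finset.card_univ, Fintype.card_fin] at key
  refine le_trans ?_ key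
  unfold dirSum
  refine Finset.sum_le_sum fun i _ => Finset.sum_le_sum fun k _ => ?_
  have hcos : (inner ℝ u (enum F k - enum F i) / dist (enum F i) (enum F k)) ^ 2 ≤ 1 := by
    rw [sq_le_one_iff_abs_le_one, abs_div]
    by_cases hd : dist (enum F i) (enum F k) = 0
    · rw [hd, abs_zero, div_zero]; exact zero_le_one
    · rw [div_le_one (abs_pos.mpr hd)]
      calc |inner ℝ u (enum F k - enum F i)| ≤ ‖u‖ * ‖enum F k - enum F i‖ := abs_real_inner_le_norm _ _
        _ = dist (enum F i) (enum F k) := by rw [hu, one_mul, dist_eq_norm, ← norm_neg, neg_sub]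
        _ ≤ |dist (enum F i) (enum F k)| := le_abs_self _
  calc (dist (enum F i) (enum F k))⁻¹ ^ 12 * (inner ℝ u (enum F k - enum F i) / dist (enum F i) (enum F k)) ^ 2
      ≤ (dist (enum F i) (enum F k))⁻¹ ^ 12 * 1 := by
        apply mul_le_mul_of_nonneg_left hcos (by positivity)
    _ = _ := mul_one _

/-- `#(Y ∩ cube(c, ℓ)) ≤ (2ℓ/δ + 1)³` for a `δ`-separated `Y`. -/
theorem card_cube_le (Y : Set E3) {δ : ℝ} (hδ : 0 < δ) (hsep : ∀ z ∈ Y, ∀ w ∈ Y, z ≠ w → δ ≤ dist z w)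
    (c : E3) {ℓ : ℝ} (hℓ : 0 ≤ ℓ) (F : Finset E3)
    (hF : (↑F : Set E3) = Y ∩ {z | ∀ i : Fin 3, c i ≤ z i ∧ z i < c i + ℓ}) :
    (F.card : ℝ) ≤ (2 * ℓ / δ + 1) ^ 3 := by
  have hmem : ∀ z ∈ F, z ∈ Y ∧ ∀ i : Fin 3, c i ≤ z i ∧ z i < c i + ℓ := fun z hz => by
    have : z ∈ (↑F : Set E3) := hz
    rw [hF] at this
    exact this
  have key := card_le_of_separated_of_box F (fun i => c i) (fun _ => ℓ) hδ (fun _ => hℓ)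
    (fun z hz i => (hmem z hz).2 i) (fun z hz w hw hzw => hsep z (hmem z hz).1 w (hmem w hw).1 hzw)
  simpa [Finset.prod_const] using key

/-! ## §2 (the indexed family `layerPoint a b w (l, i, j) = (i a + j b) + w l`, `layerPoint_injective` — tree, …NashForceBalanceLayers) -/

/-! ## §3 Sums over a chunk as sums over its index set; layer counts -/

section chunk
variable {a b : E3} {w : ℤ → E3}

/-- the index set of a chunk `F ⊆ Layered a b w`. -/
noncomputable def idx (a b : E3) (w : ℤ → E3) (hinj : Function.Injective (layerPoint a b w)) (F : Finset E3) :
    Finset (ℤ × ℤ × ℤ) :=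
  F.preimage (layerPoint a b w) (hinj.injOn)

/-- membership in the index set `idx`. -/
theorem mem_idx {hinj : Function.Injective (layerPoint a b w)} {F : Finset E3} {s : ℤ × ℤ × ℤ} :
    s ∈ idx a b w hinj F ↔ layerPoint a b w s ∈ F := Finset.mem_preimage

/-- ★ sum transfer. -/
theorem sum_eq_sum_idx (hinj : Function.Injective (layerPoint a b w)) (F : Finset E3) (hF : (↑F : Set E3) ⊆ Layered a b w)
    {M : Type*} [AddCommMonoid M] (g : E3 → M) :
    ∑ x ∈ F, g x = ∑ s ∈ idx a b w hinj F, g (layerPoint a b w s) := by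
  unfold idx
  rw [Finset.sum_preimage (layerPoint a b w) F hinj.injOn g]
  intro x hx hxr
  obtain ⟨m, i, j, rfl⟩ := hF hx
  exact absurd ⟨(m, i, j), rfl⟩ hxr

/-- cardinal transfer. -/
theorem card_eq_card_idx (hinj : Function.Injective (layerPoint a b w)) (F : Finset E3) (hF : (↑F : Set E3) ⊆ Layered a b w) :
    F.card = (idx a b w hinj F).card := by
  have h1 : ((F.card : ℕ) : ℕ) = ∑ x ∈ F, (1 : ℕ) := by simp
  rw [h1, sum_eq_sum_idx hinj F hF (fun _ => (1 : ℕ))]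
  simp

/-- the number of atoms of the chunk in layer `k`. -/
noncomputable def layerCount (hinj : Function.Injective (layerPoint a b w)) (F : Finset E3) (k : ℤ) : ℕ :=
  ((idx a b w hinj F).filter fun s => s.1 = k).card

/-- ★ layerwise summation: `Σ_{x ∈ F} G(layer x) = Σ_{k ∈ layers F} N_k • G k`. -/
theorem sum_layerwise (hinj : Function.Injective (layerPoint a b w)) (F : Finset E3)
    {M : Type*} [AddCommMonoid M] (G : ℤ → M) :
    ∑ s ∈ idx a b w hinj F, G s.1 = ∑ k ∈ (idx a b w hinj F).image (fun s => s.1), layerCount hinj F k • G k := by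
  rw [Finset.sum_comp]
  rfl

/-- the layer counts add up to the chunk. -/
theorem sum_layerCount (hinj : Function.Injective (layerPoint a b w)) (F : Finset E3) (hF : (↑F : Set E3) ⊆ Layered a b w) :
    ∑ k ∈ (idx a b w hinj F).image (fun s => s.1), layerCount hinj F k = F.card := by
  rw [card_eq_card_idx hinj F hF]
  exact (Finset.card_eq_sum_card_fiberwise fun s hs => Finset.mem_image_of_mem (fun s : ℤ × ℤ × ℤ => s.1) hs).symm

end chunk

end Summit.AtomisticToContinuum.Crystallization.Theorems.ChartedPlanarOrderPlanesCount
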